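import Mathlib
import Summits.PneNP.PneNP.Theorems.OneSliceSliceTargetSplitStability

/-!
# Route OneSlice, crux `SliceTarget` (stmt-PneNP-2832) — split `SliceTarget ⟸ MonotoneContinuation ∧ SingleThreshold`,
# part III: the assembly

`sliceTarget_of_monotoneContinuation_of_singleThreshold :
   OneSlice.MonotoneContinuation → OneSlice.SingleThreshold → OneSlice.SliceTarget`.

Proof. Fix `c`; `MonotoneContinuation` gives `c'`; `SingleThreshold` at `c'` gives `k ≥ 3`, `δ_S > 0` and,
eventually, `err_{G(n,p)}(C') ≤ δ_S ⟹ n^{c'} < |C'|` for monotone `C'`; `MonotoneContinuation` at `(k, η := δ_S/3)`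
gives `ε > 0`. Put `δ := min (ε/2) (δ_S/3)`. Eventually in `n` (window + stability + both schedules), let `j` be
central and `C` a `{∧₂,∨₂}`-circuit with slice error `≤ δ·#slice_j`; suppose `|C| ≤ n^c`. With `T` the slice-`j`
transport (part I) and `κ = CLIQUE_k`:
`‖T𝟙[C] − T𝟙[κ]‖ ≤ δ` (contraction, part I) and `‖T𝟙[κ] − 𝟙[κ]‖ ≤ δ` (stability, part II; eventually), so the
MONOTONE function `κ` witnesses the continuation hypothesis (`‖𝟙[κ] − T𝟙[C]‖ ≤ 2δ ≤ ε`); `MonotoneContinuation`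
returns a monotone `C'` with `|C'| ≤ n^{c'}` and `‖𝟙[C'] − T𝟙[C]‖ ≤ δ_S/3`, whence
`err(C') = ‖𝟙[C'] − 𝟙[κ]‖ ≤ δ_S/3 + δ + δ ≤ δ_S` and `SingleThreshold` gives `n^{c'} < |C'| ≤ n^{c'}` — absurd.
Hence `n^c < |C|`.

The read-back `rdist_eq_l1` identifies the item's inline distance with the `L¹(G(n,p_c))` distance to the
transport of part I; the item `MonotoneContinuation` is consumed by name (unfolded, no restatement).
Strategist seat planner-cstrat-stmt-PneNP-2832-r1-0, 2026-08-17 (landed by prover-pitem-stmt-PneNP-18972-c1-0).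
-/

set_option linter.dupNamespace false -- `Summit.PneNP.PneNP.…`: summit = sub-problem (D-0017)

namespace Summit.PneNP.PneNP.Theorems.SliceTargetSplit

open Literature.Computability.Complexity hiding supp mem_supp
open Finset hiding slice
open Filter hiding mem_sdiff
open Classical
open Summit.PneNP.PneNP.Theorems.ConstantBand.Negative (Edge thr Central slice errSet)
open Summit.PneNP.PneNP.Theorems.SliceACZero.Negative (supp mem_supp card_supp supp_injective
  supp_indicator)
open Summit.PneNP.PneNP.Theorems.SingleThreshold.Negative (pc err LowerBoundAt singleThreshold_iff_lib tendsto_pc)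
open Summit.PneNP.PneNP.Theorems.SliceTarget.Negative (SliceLB sliceTarget_iff errSet_subset_slice)
open Summit.PneNP.PneNP.Theses.OneSlice (SliceTarget SingleThreshold MonotoneContinuation)

noncomputable section

/-! ### Read-back of the item `MonotoneContinuation`: its inline distance is `l1` to the transport -/

variable {n : ℕ}

/-- The item's denominator is the neighbourhood size. [folklore] -/
theorem filter_inline_eq_nbhd (j : ℕ) (y : Edge n → Bool) :
    (Finset.univ.filter (fun x : ((⊤ : SimpleGraph (Fin n)).edgeSet) → Bool => (Finset.univ.filter (fun e => x e = true)).card = j ∧ ((∀ e, x e = true → y e = true) ∨ (∀ e, y e = true → x e = true)))) = nbhd j y := by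
  ext x
  simp only [Finset.mem_filter, Finset.mem_univ, true_and, mem_nbhd, Comp, edgeCount]

/-- The item's numerator is the transported mass of `𝟙[C]`. [folklore] -/
theorem card_filter_inline_eq_sum (j : ℕ) (C : Circuit (Edge n)) (y : Edge n → Bool) :
    ((Finset.univ.filter (fun x : ((⊤ : SimpleGraph (Fin n)).edgeSet) → Bool => (Finset.univ.filter (fun e => x e = true)).card = j ∧ ((∀ e, x e = true → y e = true) ∨ (∀ e, y e = true → x e = true)) ∧ C.eval x = true)).card : ℝ)
      = ∑ x ∈ nbhd j y, ind C.eval x := by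
  have h : (Finset.univ.filter (fun x : ((⊤ : SimpleGraph (Fin n)).edgeSet) → Bool => (Finset.univ.filter (fun e => x e = true)).card = j ∧ ((∀ e, x e = true → y e = true) ∨ (∀ e, y e = true → x e = true)) ∧ C.eval x = true))
      = (nbhd j y).filter fun x => C.eval x = true := by
    ext x
    simp only [Finset.mem_filter, Finset.mem_univ, true_and, mem_nbhd, Comp, edgeCount, and_assoc]
  rw [h]
  unfold ind
  rw [sum_boole]

/-- **Read-back.** The item's inline distance between a Boolean function `G` and the slice-`j` profile of `C`
(verbatim text of `MonotoneContinuation`, stmt-PneNP-18471) is the `L¹(G(n,p_c))` distance of part I between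
`𝟙[G]` and the transport of `𝟙[C]`. [folklore] -/
theorem rdist_eq_l1 (k j : ℕ) (C : Circuit (Edge n)) (G : (Edge n → Bool) → Bool) :
    (Finset.univ.sum (fun y : ((⊤ : SimpleGraph (Fin n)).edgeSet) → Bool => ((n : ℝ) ^ (-(2 : ℝ) / ((k : ℝ) - 1))) ^ (Finset.univ.filter (fun e => y e = true)).card * (1 - ((n : ℝ) ^ (-(2 : ℝ) / ((k : ℝ) - 1)))) ^ (n.choose 2 - (Finset.univ.filter (fun e => y e = true)).card) * |(if G y = true then (1 : ℝ) else 0) - ((Finset.univ.filter (fun x : ((⊤ : SimpleGraph (Fin n)).edgeSet) → Bool => (Finset.univ.filter (fun e => x e = true)).card = j ∧ ((∀ e, x e = true → y e = true) ∨ (∀ e, y e = true → x e = true)) ∧ C.eval x = true)).card : ℝ) / ((Finset.univ.filter (fun x : ((⊤ : SimpleGraph (Fin n)).edgeSet) → Bool => (Finset.univ.filter (fun e => x e = true)).card = j ∧ ((∀ e, x e = true → y e = true) ∨ (∀ e, y e = true → x e = true)))).card : ℝ)|))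
      = l1 n (pc n k) (ind G) (transport j (ind C.eval)) := by
  unfold l1
  refine sum_congr rfl fun y _ => ?_
  rw [card_filter_inline_eq_sum j C y, filter_inline_eq_nbhd j y]
  rfl

/-! ### Stability of `CLIQUE_k`, eventually -/

/-- **Eventually, the transport moves `CLIQUE_k` by at most `τ` in `L¹(G(n,p_c))`**, uniformly over central slices
(part II with `L = m - m^{3/4}`, `W = 2m^{3/4}`, `t = m^{3/4}/2`, `m = m_k(n) → ∞`). Also records `0 < p_c ≤ 1`
and `j ≤ C(n,2)` for central `j`. [folklore] -/
theorem eventually_stability {k : ℕ} (hk : 3 ≤ k) {τ : ℝ} (hτ : 0 < τ) :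
    ∀ᶠ n : ℕ in atTop, 0 < pc n k ∧ pc n k ≤ 1 ∧ ∀ j : ℕ, Central k n j → j ≤ n.choose 2 ∧
      l1 n (pc n k) (transport j (ind (cliqueFn n k))) (ind (cliqueFn n k)) ≤ τ := by
  set K : ℝ := ((k.choose 2 : ℕ) : ℝ) with hK
  have hK0 : 0 ≤ K := Nat.cast_nonneg _
  have hm : Tendsto (fun n : ℕ => (thr k n : ℝ)) atTop atTop :=
    tendsto_natCast_atTop_atTop.comp (tendsto_nat_floor_atTop.comp (tendsto_mean hk))
  have hA : Tendsto (fun n : ℕ => (thr k n : ℝ) ^ ((1 : ℝ) / 4)) atTop atTop :=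
    (tendsto_rpow_atTop (by norm_num)).comp hm
  filter_upwards [eventually_window hk 0, hA.eventually_ge_atTop (max 2 ((4 * K + 8) / τ))]
    with n hwin hAge
  obtain ⟨hp0, hp8, h34, h32, hwin5⟩ := hwin
  have hp1 : pc n k ≤ 1 := by linarith
  refine ⟨hp0, hp1, fun j hj => ?_⟩
  have hjN : j ≤ n.choose 2 := by simpa using central_add_le (w := 0) hp0 hp8 hwin5 hj
  refine ⟨hjN, ?_⟩
  -- the scales `m = A⁴`, `R = m^{3/4} = A³`
  set m : ℝ := (thr k n : ℝ) with hmdef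
  set A : ℝ := m ^ ((1 : ℝ) / 4) with hAdef
  set R : ℝ := m ^ ((3 : ℝ) / 4) with hRdef
  have hm0 : 0 ≤ m := Nat.cast_nonneg _
  have hA2 : 2 ≤ A := le_trans (le_max_left _ _) hAge
  have hAτ : (4 * K + 8) / τ ≤ A := le_trans (le_max_right _ _) hAge
  have hA0 : 0 < A := by linarith
  have hA1 : 1 ≤ A := by linarith
  have hmA : m = A ^ 4 := by
    rw [hAdef, ← Real.rpow_natCast, ← Real.rpow_mul hm0]; norm_num
  have hRA : R = A ^ 3 := by
    rw [hRdef, hAdef, ← Real.rpow_natCast, ← Real.rpow_mul hm0]; norm_num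
  have hR2 : 2 ≤ R := h34
  have hR0 : 0 < R := by linarith
  have hmpos : 0 < m := by rw [hmA]; positivity
  -- `2R ≤ m`
  have h2R : 2 * R ≤ m := by
    rw [hRA, hmA]
    nlinarith [pow_pos hA0 3]
  have hL0 : 0 < m - R := by linarith
  -- centrality of `j` and the mean
  have hjc := abs_le.1 hj
  have hμ0 : 0 ≤ ((n.choose 2 : ℕ) : ℝ) * pc n k := mul_nonneg (Nat.cast_nonneg _) hp0.le
  have hmμ : m ≤ ((n.choose 2 : ℕ) : ℝ) * pc n k := Nat.floor_le hμ0
  have hμm : ((n.choose 2 : ℕ) : ℝ) * pc n k < m + 1 := Nat.lt_floor_add_one _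
  have hmain := l1_transport_clique_le (n := n) (k := k) hp0.le hp1 hjN
    (fun i : ℕ => |(i : ℝ) - m| ≤ R) hL0 (by linarith : (0 : ℝ) ≤ 2 * R) (half_pos hR0)
    (by linarith [hjc.1])
    (fun i hi => by
      have := abs_le.1 hi
      refine ⟨by linarith [this.1], ?_⟩
      calc |(i : ℝ) - j| ≤ |(i : ℝ) - m| + |(m : ℝ) - j| := abs_sub_le _ _ _
        _ ≤ R + R := add_le_add hi (by rw [abs_sub_comm]; exact hj)
        _ = 2 * R := by ring)
    (fun i _ hi => by
      push Not at hi
      have h1 : |(i : ℝ) - m| ≤ |(i : ℝ) - (n.choose 2 : ℕ) * pc n k| + |((n.choose 2 : ℕ) : ℝ) * pc n k - m| :=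
        abs_sub_le _ _ _
      have h2 : |((n.choose 2 : ℕ) : ℝ) * pc n k - m| < 1 := by
        rw [abs_lt]; constructor <;> linarith
      linarith)
  refine hmain.trans ?_
  -- `K·2R/(m-R) + μ(1-p)/(R/2)² ≤ 4K/A + 8/A² ≤ (4K+8)/A ≤ τ`
  have hNp : ((n.choose 2 : ℕ) : ℝ) * pc n k * (1 - pc n k) ≤ m + 1 := by
    have : ((n.choose 2 : ℕ) : ℝ) * pc n k * (1 - pc n k) ≤ ((n.choose 2 : ℕ) : ℝ) * pc n k := by
      nlinarith [hμ0, hp0.le]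
    linarith
  have hterm1 : (k.choose 2 : ℝ) * (2 * R) / (m - R) ≤ 4 * K / A := by
    rw [← hK, div_le_div_iff₀ hL0 hA0, hRA, hmA]
    -- K·2A³·A ≤ 4K·(A⁴ - A³)  ⟸  2A⁴ ≤ 4A⁴ - 4A³ ⟸ 4A³ ≤ 2A⁴ ⟸ 2 ≤ A
    have hA3 : 0 < A ^ 3 := pow_pos hA0 3
    nlinarith [mul_nonneg hK0 hA3.le, hA2]
  have hterm2 : ((n.choose 2 : ℕ) : ℝ) * pc n k * (1 - pc n k) / (R / 2) ^ 2 ≤ 8 / A := by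
    have hR2pos : 0 < (R / 2) ^ 2 := by positivity
    rw [div_le_div_iff₀ hR2pos hA0]
    calc ((n.choose 2 : ℕ) : ℝ) * pc n k * (1 - pc n k) * A ≤ (m + 1) * A :=
          mul_le_mul_of_nonneg_right hNp hA0.le
      _ = (A ^ 4 + 1) * A := by rw [hmA]
      _ ≤ 8 * (R / 2) ^ 2 := by
          rw [hRA]
          have hA4 : 1 ≤ A ^ 4 := one_le_pow₀ hA1
          nlinarith [pow_pos hA0 2, pow_pos hA0 5, hA1, hA4]
  have hsum : 4 * K / A + 8 / A ≤ τ := by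
    rw [← add_div, div_le_iff₀ hA0]
    rw [div_le_iff₀ hτ] at hAτ
    linarith
  linarith [hterm1, hterm2, hsum]

/-! ### The assembly -/

/-- The slice-`j` error fraction of `C` against `CLIQUE_k`, as a counting sum. [folklore] -/
theorem sum_slice_abs_ind_eval_sub (k j : ℕ) (C : Circuit (Edge n)) :
    ∑ x ∈ slice n j, |ind C.eval x - ind (cliqueFn n k) x| = #(errSet n k j C) := by
  rw [sum_slice_abs_ind_sub_ind]
  congr 2
  ext x
  simp only [errSet, slice, mem_filter, mem_univ, true_and]

/-- **The split's assembly: `MonotoneContinuation → SingleThreshold → SliceTarget`** (route items by name).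
[folklore] -/
theorem sliceTarget_of_monotoneContinuation_of_singleThreshold (hMC : MonotoneContinuation)
    (hST : SingleThreshold) : SliceTarget := by
  unfold MonotoneContinuation at hMC
  rw [sliceTarget_iff]
  rw [singleThreshold_iff_lib] at hST
  intro c
  obtain ⟨c', hc'⟩ := hMC c
  obtain ⟨k, hk, δS, hδS, hLB⟩ := hST c'
  obtain ⟨ε, hε, hCont⟩ := hc' k hk (δS / 3) (by positivity)
  set δ : ℝ := min (ε / 2) (δS / 3) with hδdef
  have hδ : 0 < δ := lt_min (by positivity) (by positivity)
  have hδε : δ ≤ ε / 2 := min_le_left _ _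
  have hδS3 : δ ≤ δS / 3 := min_le_right _ _
  refine ⟨k, hk, δ, hδ, ?_⟩
  unfold SliceLB
  filter_upwards [hCont, hLB, eventually_stability hk hδ] with n hContn hLBn hstab j hj C hC herr
  obtain ⟨hp0, hp1, hstab'⟩ := hstab
  obtain ⟨hjN, hstabj⟩ := hstab' j hj
  by_contra hlt
  push Not at hlt
  set p : ℝ := pc n k with hp
  set κ : (Edge n → Bool) → Bool := cliqueFn n k with hκ
  -- (s1) contraction: `‖T𝟙[C] − T𝟙[κ]‖ ≤ δ`
  have d1 : l1 n p (transport j (ind C.eval)) (transport j (ind κ)) ≤ δ := by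
    refine (l1_transport_le hp0.le hp1 j (ind C.eval) (ind κ)).trans ?_
    rw [sum_slice_abs_ind_eval_sub]
    rcases Nat.eq_zero_or_pos #(slice n j) with hs | hs
    · rw [hs, Nat.cast_zero, div_zero]; exact hδ.le
    · rw [div_le_iff₀ (by exact_mod_cast hs)]
      exact herr
  -- (s2) stability: `‖T𝟙[κ] − 𝟙[κ]‖ ≤ δ`
  have d2 : l1 n p (transport j (ind κ)) (ind κ) ≤ δ := hstabj
  -- (s3) the monotone witness `κ`: `‖𝟙[κ] − T𝟙[C]‖ ≤ 2δ ≤ ε`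
  have hF : l1 n p (ind κ) (transport j (ind C.eval)) ≤ ε := by
    calc l1 n p (ind κ) (transport j (ind C.eval))
        ≤ l1 n p (ind κ) (transport j (ind κ)) + l1 n p (transport j (ind κ)) (transport j (ind C.eval)) :=
          l1_triangle hp0.le hp1 _ _ _
      _ ≤ δ + δ := add_le_add (by rw [l1_comm]; exact d2) (by rw [l1_comm]; exact d1)
      _ ≤ ε := by linarith
  rw [hp, ← rdist_eq_l1] at hF
  -- (s4) the continuation `C'` is too accurate for `SingleThreshold`
  obtain ⟨C', hC', hsz', hd'⟩ := hContn j hj C hC hlt ⟨κ, cliqueFn_monotone_holds n k, hF⟩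
  replace hd' : l1 n p (ind C'.eval) (transport j (ind C.eval)) ≤ δS / 3 := by
    rw [hp, ← rdist_eq_l1]
    exact hd'
  have herr' : err n k C' ≤ δS := by
    change gnpProb n p (univ.filter fun x => C'.eval x ≠ cliqueFn n k x) ≤ δS
    rw [← l1_ind_ind]
    calc l1 n p (ind C'.eval) (ind κ)
        ≤ l1 n p (ind C'.eval) (transport j (ind C.eval)) + l1 n p (transport j (ind C.eval)) (ind κ) :=
          l1_triangle hp0.le hp1 _ _ _
      _ ≤ δS / 3 + (l1 n p (transport j (ind C.eval)) (transport j (ind κ)) + l1 n p (transport j (ind κ)) (ind κ)) :=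
          add_le_add hd' (l1_triangle hp0.le hp1 _ _ _)
      _ ≤ δS / 3 + (δ + δ) := by linarith
      _ ≤ δS := by linarith
  exact absurd (hLBn C' hC' herr') (not_lt.2 hsz')

end

end Summit.PneNP.PneNP.Theorems.SliceTargetSplit
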